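import Summits.PneNP.PneNP.Theorems.NoFBPPApproxAboveUniqueness.Negative.FalseOfNPSubsetBPP
import Summits.PneNP.PneNP.Theorems.PhaseTwinsNoFBPPApproxAboveUniquenessFactFree

/-!
# The fact-free calibration of crux stmt-PneNP-2717: `NoFBPPApproxAboveUniqueness ⟺ ¬(NP ⊆ BPP)`

Line `SketchIdeator1` (card `stockmeyer-bpp-calibration`). Both directions kernel-checked with NO named fact:

* `⟹`: Theorem N (`Negative.noFBPPApproxAboveUniqueness_false_of_NP_subset_BPP`: lever + `#P`-membership of the
  hard-core count + `Negative.not_crux_of_hasFPRAS`);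
* `⟸`: a disproof of the crux is a family of FPRASes above the threshold (`Negative.not_crux_iff`), which gives
  `NP ⊆ BPP` by the fact-free corner (`NP_subset_BPP_of_hardcoreFPRAS_everywhere`: the tree's proved PCP theorem,
  bounded-occurrence gap-E3SAT, the counting window on conflict graphs, an FPRAS-driven `BPP` decider).

So the crux is EXACTLY `NP ⊄ BPP`: neither provable nor refutable below a resolution of `NP` versus `BPP`; the
line's one open stub is that conjecture itself.
-/

set_option linter.dupNamespace false

namespace Summit.PneNP.PneNP.Theorems.NoFBPPApproxAboveUniqueness

open Literature.Computability.Complexity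
open Summit.PneNP.PneNP.Theses.PhaseTwins (NoFBPPApproxAboveUniqueness)

/-- **The calibration, fact-free** (registered sub-goal of the line). `NoFBPPApproxAboveUniqueness ↔ ¬(NP ⊆ BPP)`.
[folklore] -/
theorem noFBPPApproxAboveUniqueness_iff_not_NP_subset_BPP : NoFBPPApproxAboveUniqueness ↔ ¬ (Nondeterministic.NP ⊆ BPP) :=
  ⟨fun hX hNP => Negative.noFBPPApproxAboveUniqueness_false_of_NP_subset_BPP hNP hX,
    fun h => by
      by_contra hX
      exact h (NP_subset_BPP_of_hardcoreFPRAS_everywhere (Negative.not_crux_iff.1 hX))⟩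

/-- **The positive conditional, fact-free.** `NP ⊄ BPP → NoFBPPApproxAboveUniqueness`. [folklore] -/
theorem noFBPPApproxAboveUniqueness_of_not_NP_subset_BPP (h : ¬ (Nondeterministic.NP ⊆ BPP)) :
    NoFBPPApproxAboveUniqueness :=
  noFBPPApproxAboveUniqueness_iff_not_NP_subset_BPP.2 h

end Summit.PneNP.PneNP.Theorems.NoFBPPApproxAboveUniqueness
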